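import Mathlib
import Summits.Ventures.PercRepro2.Defs
import Summits.Ventures.PercRepro2.Graph
import Summits.Ventures.PercRepro2.OneColourSwitch
import Summits.Ventures.PercRepro2.RegionHubSign
import Summits.Ventures.PercRepro2.SideSwitch
import Summits.Ventures.PercRepro2.TermSwitchDefs
import Summits.Ventures.PercRepro2.M9NoPocketDefs

/-!
# The partner map `Ψ₁` of a doubly-reached colouring: definitions and the colour table
(blind cell PercRepro2, p3 g31, 2026-08-28; `proofs/P3-PAYMENT.md` §1–§2)

For a colouring `ω ∈ Sep ∧ DOne(d)` with `d ∈ K₂ ∩ M₂` (an `EX` colouring) and no edge at `d`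
to `r, s`, the vertices split into `{r, s, d}`, the `Y`-core `K₂ ∖ {r, s, d}`, the `W`-core
`M₂ ∖ {r, s, d}` and the outside `V ∖ (K₂ ∪ M₂)`.  The BLOCKS are the components of the cores
under all edges (`blockIn`); the blocks JOINED to `d` (`joinedY`, `joinedW`) are the all-edge
explorations of `d`'s core neighbours; a `Y`-core vertex is LINKING (`linkingY`) if `r ~_Y s`
using only the edges inside its block and `{r, s}`.  The partner `psiOne ω` keeps the colour of
every edge touching a joined `Y`-block or a linking vertex and of every edge from `d` into a
joined `W`-block, and flips every other edge.  This file: the definitions, the colour table of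
an `EX` colouring (`no_edge_core_core`, `edge_Kcore_d`, `edge_Kcore_out`, `no_edge_d_out`,
`edge_Kcore_r`, `no_edge_out_r`, with the `W`-mirrors), the block facts (the joined and linking
sets are closed under core adjacency and contain `d`'s core neighbours) and the colours of
`psiOne ω`.  The claims of the theorem (legality, `σ_rs` kept, `σ_pq` reversed, injectivity)
are the successor files.  Own work; std axioms.
-/

namespace Summit.Ventures.PercRepro2

namespace NoPocket

open Finset Classical RegionHub OneColourSwitch SideSwitch TermSwitch

variable {V : Type*} {E : Type*}

section Classes

variable (ends : E → Sym2 V) (r s d : V) (ω : Config E)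

/-- The `Y`-core `K₂ ∖ {r, s, d}`. -/
def Kcore : Set V := {x | x ∈ K2 ends r s ω ∧ x ≠ r ∧ x ≠ s ∧ x ≠ d}

/-- The `W`-core `M₂ ∖ {r, s, d}`. -/
def Mcore : Set V := {x | x ∈ M2 ends r s ω ∧ x ≠ r ∧ x ≠ s ∧ x ≠ d}

/-- The outside `V ∖ (K₂ ∪ M₂)`. -/
def Outside : Set V := {x | x ∉ K2 ends r s ω ∧ x ∉ M2 ends r s ω}

/-- The all-edge configuration on a vertex set: every edge inside `S` open, every other edge
closed (so `Conn ends (allIn S)` is connectivity inside `S` under all edges). -/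
noncomputable def allIn (S : Set V) : Config E := fun e => if e ∈ within ends S then true else false

/-- The block of `x` inside `S`: its all-edge component inside `S`. -/
def blockIn (S : Set V) (x : V) : Set V := {y | Conn ends (allIn ends S) x y}

/-- The `Y`-blocks joined to `d`: the all-edge exploration, inside the `Y`-core, of the
`Y`-core neighbours of `d`. -/
def joinedY : Set V :=
  expl ends {y | y ∈ Kcore ends r s d ω ∧ ∃ e, ends e = s(d, y)} (allIn ends (Kcore ends r s d ω))

/-- The `W`-blocks joined to `d`. -/
def joinedW : Set V :=
  expl ends {y | y ∈ Mcore ends r s d ω ∧ ∃ e, ends e = s(d, y)} (allIn ends (Mcore ends r s d ω))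

/-- The colouring `ω` restricted to the edges inside `S` (every other edge closed). -/
noncomputable def restrictTo (S : Set V) : Config E :=
  fun e => if e ∈ within ends S then ω e else false

/-- A `Y`-core vertex is LINKING if `r ~_Y s` using only the edges inside its block and
`{r, s}`. -/
def linkingY (x : V) : Prop :=
  x ∈ Kcore ends r s d ω ∧
    Conn ends (restrictTo ends ω (blockIn ends (Kcore ends r s d ω) x ∪ {r, s})) r s

/-- The linking `Y`-core vertices. -/
def linkSetY : Set V := {x | linkingY ends r s d ω x}

/-- The edges kept by `Ψ₁`: the edges touching a joined `Y`-block or a linking vertex, and the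
edges from `d` into a joined `W`-block. -/
def keptEdges : Set E :=
  touches ends (joinedY ends r s d ω ∪ linkSetY ends r s d ω) ∪
    {e | ∃ y ∈ joinedW ends r s d ω, ends e = s(d, y)}

/-- **The partner map `Ψ₁`**: keep the kept edges, flip every other edge. -/
noncomputable def psiOne : Config E :=
  fun e => if e ∈ keptEdges ends r s d ω then ω e else !ω e

end Classes

section Basic

variable {ends : E → Sym2 V} {r s d : V} {ω : Config E}

/-- The `Y`-world is closed under open edges. -/
lemma mem_K2_of_open {x y : V} {e : E} (hx : x ∈ K2 ends r s ω) (he : ω e = true)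
    (hends : ends e = s(x, y)) : y ∈ K2 ends r s ω :=
  mem_KH_of_open (H := ({r, s} : Set V)) hx he hends

/-- The `W`-world is closed under closed edges. -/
lemma mem_M2_of_closed {x y : V} {e : E} (hx : x ∈ M2 ends r s ω) (he : ω e = false)
    (hends : ends e = s(x, y)) : y ∈ M2 ends r s ω :=
  mem_MH_of_closed (H := ({r, s} : Set V)) hx he hends

/-- An edge at a `Y`-world vertex whose other end is outside the `Y`-world is closed. -/
lemma closed_of_mem_K2_of_not_mem {x y : V} {e : E} (hx : x ∈ K2 ends r s ω)
    (hy : y ∉ K2 ends r s ω) (hends : ends e = s(x, y)) : ω e = false := by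
  cases h : ω e
  · rfl
  · exact (hy (mem_K2_of_open hx h hends)).elim

/-- An edge at a `W`-world vertex whose other end is outside the `W`-world is open. -/
lemma open_of_mem_M2_of_not_mem {x y : V} {e : E} (hx : x ∈ M2 ends r s ω)
    (hy : y ∉ M2 ends r s ω) (hends : ends e = s(x, y)) : ω e = true := by
  cases h : ω e
  · exact (hy (mem_M2_of_closed hx h hends)).elim
  · rfl

/-- Membership in the `Y`-core. -/
lemma mem_Kcore_iff {x : V} :
    x ∈ Kcore ends r s d ω ↔ x ∈ K2 ends r s ω ∧ x ≠ r ∧ x ≠ s ∧ x ≠ d := Iff.rfl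

/-- Membership in the `W`-core. -/
lemma mem_Mcore_iff {x : V} :
    x ∈ Mcore ends r s d ω ↔ x ∈ M2 ends r s ω ∧ x ≠ r ∧ x ≠ s ∧ x ≠ d := Iff.rfl

/-- Membership in the outside. -/
lemma mem_Outside_iff {x : V} :
    x ∈ Outside ends r s ω ↔ x ∉ K2 ends r s ω ∧ x ∉ M2 ends r s ω := Iff.rfl

/-- Under `DOne(d)` a `Y`-core vertex is not in the `W`-world. -/
lemma not_mem_M2_of_mem_Kcore (hD : DOne ends r s d ω) {x : V} (hx : x ∈ Kcore ends r s d ω) :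
    x ∉ M2 ends r s ω :=
  hD x hx.2.1 hx.2.2.1 hx.2.2.2 hx.1

/-- Under `DOne(d)` a `W`-core vertex is not in the `Y`-world. -/
lemma not_mem_K2_of_mem_Mcore (hD : DOne ends r s d ω) {x : V} (hx : x ∈ Mcore ends r s d ω) :
    x ∉ K2 ends r s ω :=
  fun h => hD x hx.2.1 hx.2.2.1 hx.2.2.2 h hx.1

/-- The cores are disjoint. -/
lemma not_mem_Mcore_of_mem_Kcore (hD : DOne ends r s d ω) {x : V}
    (hx : x ∈ Kcore ends r s d ω) : x ∉ Mcore ends r s d ω :=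
  fun h => not_mem_M2_of_mem_Kcore hD hx h.1

/-- **Every vertex is a terminal, `d`, a core vertex or outside.** -/
lemma vertex_cases (x : V) :
    x = r ∨ x = s ∨ x = d ∨ x ∈ Kcore ends r s d ω ∨ x ∈ Mcore ends r s d ω ∨
      x ∈ Outside ends r s ω := by
  by_cases hr : x = r
  · exact Or.inl hr
  by_cases hs : x = s
  · exact Or.inr (Or.inl hs)
  by_cases hd : x = d
  · exact Or.inr (Or.inr (Or.inl hd))
  by_cases hK : x ∈ K2 ends r s ω
  · exact Or.inr (Or.inr (Or.inr (Or.inl ⟨hK, hr, hs, hd⟩)))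
  by_cases hM : x ∈ M2 ends r s ω
  · exact Or.inr (Or.inr (Or.inr (Or.inr (Or.inl ⟨hM, hr, hs, hd⟩))))
  · exact Or.inr (Or.inr (Or.inr (Or.inr (Or.inr ⟨hK, hM⟩))))

end Basic

section EX

variable {ends : E → Sym2 V} {p q r s d : V} {ω : Config E}

/-- **An `EX` colouring**: `Sep ∧ DOne(d)`, `d` in both worlds, no edge at `d` to `r` or `s`,
distinct `r, s, d`. -/
structure IsEX (ends : E → Sym2 V) (p q r s d : V) (ω : Config E) : Prop where
  sep : sep2 ends p q r s ω
  done : DOne ends r s d ω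
  inK : d ∈ K2 ends r s ω
  inM : d ∈ M2 ends r s ω
  noT : ∀ e, ends e ≠ s(d, r) ∧ ends e ≠ s(d, s)
  hr : d ≠ r
  hs : d ≠ s
  hrs : r ≠ s

variable (h : IsEX ends p q r s d ω)
include h

/-- (F1) No edge joins the `Y`-core to the `W`-core. -/
lemma no_edge_core_core {x y : V} {e : E} (hx : x ∈ Kcore ends r s d ω)
    (hy : y ∈ Mcore ends r s d ω) (hends : ends e = s(x, y)) : False := by
  cases he : ω e
  · exact not_mem_M2_of_mem_Kcore h.done hx (mem_M2_of_closed hy.1 he (by rw [hends, Sym2.eq_swap]))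
  · exact not_mem_K2_of_mem_Mcore h.done hy (mem_K2_of_open hx.1 he hends)

/-- (F2) An edge from the `Y`-core to `d` is open. -/
lemma edge_Kcore_d {x : V} {e : E} (hx : x ∈ Kcore ends r s d ω) (hends : ends e = s(x, d)) :
    ω e = true := by
  cases he : ω e
  · exact (not_mem_M2_of_mem_Kcore h.done hx
      (mem_M2_of_closed h.inM he (by rw [hends, Sym2.eq_swap]))).elim
  · rfl

/-- (F2′) An edge from the `W`-core to `d` is closed. -/
lemma edge_Mcore_d {x : V} {e : E} (hx : x ∈ Mcore ends r s d ω) (hends : ends e = s(x, d)) :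
    ω e = false := by
  cases he : ω e
  · rfl
  · exact (not_mem_K2_of_mem_Mcore h.done hx
      (mem_K2_of_open h.inK he (by rw [hends, Sym2.eq_swap]))).elim

omit h in
/-- (F3) An edge from the `Y`-core to the outside is closed. -/
lemma edge_Kcore_out {x y : V} {e : E} (hx : x ∈ Kcore ends r s d ω)
    (hy : y ∈ Outside ends r s ω) (hends : ends e = s(x, y)) : ω e = false :=
  closed_of_mem_K2_of_not_mem hx.1 hy.1 hends

omit h in
/-- (F3′) An edge from the `W`-core to the outside is open. -/
lemma edge_Mcore_out {x y : V} {e : E} (hx : x ∈ Mcore ends r s d ω)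
    (hy : y ∈ Outside ends r s ω) (hends : ends e = s(x, y)) : ω e = true :=
  open_of_mem_M2_of_not_mem hx.1 hy.2 hends

/-- (F4) `d` has no edge to the outside. -/
lemma no_edge_d_out {y : V} {e : E} (hy : y ∈ Outside ends r s ω) (hends : ends e = s(d, y)) :
    False := by
  cases he : ω e
  · exact hy.2 (mem_M2_of_closed h.inM he hends)
  · exact hy.1 (mem_K2_of_open h.inK he hends)

/-- (F5) An edge from the `Y`-core to a terminal is open. -/
lemma edge_Kcore_term {x t : V} {e : E} (hx : x ∈ Kcore ends r s d ω) (ht : t = r ∨ t = s)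
    (hends : ends e = s(x, t)) : ω e = true := by
  cases he : ω e
  · have htM : t ∈ M2 ends r s ω := by
      rcases ht with rfl | rfl
      · exact mem_MH_of_mem (by simp) ω
      · exact mem_MH_of_mem (by simp) ω
    exact (not_mem_M2_of_mem_Kcore h.done hx
      (mem_M2_of_closed htM he (by rw [hends, Sym2.eq_swap]))).elim
  · rfl

/-- (F5′) An edge from the `W`-core to a terminal is closed. -/
lemma edge_Mcore_term {x t : V} {e : E} (hx : x ∈ Mcore ends r s d ω) (ht : t = r ∨ t = s)
    (hends : ends e = s(x, t)) : ω e = false := by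
  cases he : ω e
  · rfl
  · have htK : t ∈ K2 ends r s ω := by
      rcases ht with rfl | rfl
      · exact mem_KH_of_mem (by simp) ω
      · exact mem_KH_of_mem (by simp) ω
    exact (not_mem_K2_of_mem_Mcore h.done hx
      (mem_K2_of_open htK he (by rw [hends, Sym2.eq_swap]))).elim

/-- (F6) No edge joins the outside to a terminal. -/
lemma no_edge_out_term {y t : V} {e : E} (hy : y ∈ Outside ends r s ω) (ht : t = r ∨ t = s)
    (hends : ends e = s(t, y)) : False := by
  have htH : t ∈ ({r, s} : Set V) := by rcases ht with rfl | rfl <;> simp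
  exact not_edge_H_outside htH hy.1 hy.2 hends

/-- `d` is not adjacent to a terminal. -/
lemma no_edge_d_term {t : V} {e : E} (ht : t = r ∨ t = s) (hends : ends e = s(d, t)) : False := by
  rcases ht with rfl | rfl
  · exact (h.noT e).1 hends
  · exact (h.noT e).2 hends

end EX

section Blocks

variable {ends : E → Sym2 V} {r s d : V} {ω : Config E}

/-- An edge inside `S` is open in `allIn S`. -/
lemma allIn_eq_true {S : Set V} {x y : V} {e : E} (hx : x ∈ S) (hy : y ∈ S)
    (hends : ends e = s(x, y)) : allIn ends S e = true := by
  unfold allIn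
  rw [if_pos ⟨x, hx, y, hy, hends⟩]

/-- Core vertices joined by an edge lie in the same block. -/
lemma conn_allIn_of_edge {S : Set V} {x y : V} {e : E} (hx : x ∈ S) (hy : y ∈ S)
    (hends : ends e = s(x, y)) : Conn ends (allIn ends S) x y :=
  conn_of_openAdj ⟨e, allIn_eq_true hx hy hends, hends⟩

/-- The joined `Y`-set contains every `Y`-core neighbour of `d`. -/
lemma mem_joinedY_of_nbr {y : V} {e : E} (hy : y ∈ Kcore ends r s d ω) (hends : ends e = s(d, y)) :
    y ∈ joinedY ends r s d ω :=
  ⟨y, ⟨hy, e, hends⟩, conn_refl _ _ _⟩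

/-- The joined `W`-set contains every `W`-core neighbour of `d`. -/
lemma mem_joinedW_of_nbr {y : V} {e : E} (hy : y ∈ Mcore ends r s d ω) (hends : ends e = s(d, y)) :
    y ∈ joinedW ends r s d ω :=
  ⟨y, ⟨hy, e, hends⟩, conn_refl _ _ _⟩

/-- The all-edge exploration of a subset of `S` stays inside `S`. -/
lemma expl_allIn_subset {S H : Set V} (hH : H ⊆ S) : expl ends H (allIn ends S) ⊆ S := by
  rintro x ⟨h₀, hh₀, hc⟩
  refine mem_of_conn_of_closed (ends := ends) (ω := allIn ends S) ?_ (hH hh₀) hc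
  intro u hu v huv
  obtain ⟨_, e, he, hends⟩ := openGraph_adj.1 huv
  unfold allIn at he
  by_cases hw : e ∈ within ends S
  · obtain ⟨a, ha, b, hb, hab⟩ := hw
    rw [hends, Sym2.eq_iff] at hab
    rcases hab with ⟨rfl, rfl⟩ | ⟨rfl, rfl⟩
    · exact hb
    · exact ha
  · rw [if_neg hw] at he
    exact absurd he Bool.false_ne_true

/-- The joined `Y`-set lies in the `Y`-core. -/
lemma joinedY_subset_Kcore : joinedY ends r s d ω ⊆ Kcore ends r s d ω :=
  expl_allIn_subset (fun _ hy => hy.1)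

/-- The joined `W`-set lies in the `W`-core. -/
lemma joinedW_subset_Mcore : joinedW ends r s d ω ⊆ Mcore ends r s d ω :=
  expl_allIn_subset (fun _ hy => hy.1)

/-- The linking set lies in the `Y`-core. -/
lemma linkSetY_subset_Kcore : linkSetY ends r s d ω ⊆ Kcore ends r s d ω :=
  fun _ hx => hx.1

/-- The joined `Y`-set is closed under edges inside the `Y`-core. -/
lemma mem_joinedY_of_edge {x y : V} {e : E} (hx : x ∈ joinedY ends r s d ω)
    (hy : y ∈ Kcore ends r s d ω) (hends : ends e = s(x, y)) : y ∈ joinedY ends r s d ω := by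
  obtain ⟨h₀, hh₀, hc⟩ := hx
  exact ⟨h₀, hh₀, conn_trans hc (conn_allIn_of_edge (joinedY_subset_Kcore ⟨h₀, hh₀, hc⟩) hy hends)⟩

/-- The joined `W`-set is closed under edges inside the `W`-core. -/
lemma mem_joinedW_of_edge {x y : V} {e : E} (hx : x ∈ joinedW ends r s d ω)
    (hy : y ∈ Mcore ends r s d ω) (hends : ends e = s(x, y)) : y ∈ joinedW ends r s d ω := by
  obtain ⟨h₀, hh₀, hc⟩ := hx
  exact ⟨h₀, hh₀, conn_trans hc (conn_allIn_of_edge (joinedW_subset_Mcore ⟨h₀, hh₀, hc⟩) hy hends)⟩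

/-- Blocks of connected vertices coincide. -/
lemma blockIn_eq_of_conn {S : Set V} {x y : V} (hc : Conn ends (allIn ends S) x y) :
    blockIn ends S x = blockIn ends S y := by
  ext z
  constructor
  · intro hz; exact conn_trans (conn_symm hc) hz
  · intro hz; exact conn_trans hc hz

/-- The linking set is closed under edges inside the `Y`-core. -/
lemma mem_linkSetY_of_edge {x y : V} {e : E} (hx : x ∈ linkSetY ends r s d ω)
    (hy : y ∈ Kcore ends r s d ω) (hends : ends e = s(x, y)) : y ∈ linkSetY ends r s d ω := by
  obtain ⟨hxK, hc⟩ := hx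
  refine ⟨hy, ?_⟩
  rwa [blockIn_eq_of_conn (conn_allIn_of_edge hxK hy hends)] at hc

/-- An edge with an end in a joined `Y`-block or a linking vertex is kept. -/
lemma mem_keptEdges_of_touches {x y : V} {e : E}
    (hx : x ∈ joinedY ends r s d ω ∪ linkSetY ends r s d ω) (hends : ends e = s(x, y)) :
    e ∈ keptEdges ends r s d ω :=
  Or.inl ⟨x, hx, y, hends⟩

/-- An edge from `d` into a joined `W`-block is kept. -/
lemma mem_keptEdges_of_dW {y : V} {e : E} (hy : y ∈ joinedW ends r s d ω)
    (hends : ends e = s(d, y)) : e ∈ keptEdges ends r s d ω :=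
  Or.inr ⟨y, hy, hends⟩

/-- The colour of `Ψ₁ ω` on a kept edge. -/
lemma psiOne_of_kept {e : E} (he : e ∈ keptEdges ends r s d ω) : psiOne ends r s d ω e = ω e := by
  unfold psiOne; rw [if_pos he]

/-- The colour of `Ψ₁ ω` on a flipped edge. -/
lemma psiOne_of_not_kept {e : E} (he : e ∉ keptEdges ends r s d ω) :
    psiOne ends r s d ω e = !ω e := by
  unfold psiOne; rw [if_neg he]

end Blocks

end NoPocket

end Summit.Ventures.PercRepro2
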